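import Summits.BirchSwinnertonDyer.Rank1Residual.Additive.TameBranchOneValueCertificateJoin
import Summits.BirchSwinnertonDyer.Rank1Residual.Additive.CensusX43TeichmullerPow
import Summits.BirchSwinnertonDyer.Rank1Residual.Additive.TameBranchTeichmuller
import HarnessLib

/-!
# CHARACTER-FREE, FIELD-FREE, ONE NUMBER: on X4♯(G-ord) ∩ {e ∈ {3,4,6}} ∩ {r_an = 1} the whole
# per-pair input of the tame-branch route is ONE `p`-adic valuation `ord_p Σ_b κ(b)[b/p^{n+1+e₀}]⁺_f
# = 1/φ(pⁿ⁺¹) + 1/e` (cell `b2b-bsdres`, sub-cell additive-p2 = X3♯(G-ord)/X4♯(G-ord), gen 27; part 5)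

HONEST FRAMING (cell `b2b-bsdres`, run/shared/lean/b2b/bsd-rank1-residual/, verbatim in every
file): the goal of the cell is to DELETE the COMBINATION-SHAPED residual classes of the
Birch–Swinnerton-Dyer formula for ALL analytic-rank `≤ 1` elliptic curves over `ℚ` — "full BSD
formula for every rank `≤ 1` curve in class `C`" assembled STRICTLY from published theorems — so
that the rank-`≤ 1` remainder becomes exactly the CONSTRUCTION-SHAPED classes, which are TYPED
(missing-input `Prop`s), NOT attempted. This is not "finishing BSD". Sub-cell additive-p2: the
classes X3♯(G-ord) / X4♯(G-ord) are CONSTRUCTION-SHAPED and stay so; labels / RESIDUAL-MAP marks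
UNCHANGED; nothing is booked. Theorems only; the named facts enter as hypothesis binders
(`Delbourgo1998.thm1_exists_bounded_evenMeasure` A282, `Delbourgo2002.mainTheorem` A175,
`Delbourgo2002.thmC_charIdeal_dvd_tameBranch` A227, `Delbourgo2002.mainTheorem_potMult`, GZK).
No definition, no `sorry`.

## What

Part 4 (`TameBranchOneValueCertificateJoin.lean`) took as per-pair data a character `χ = ω^u` of
`ℤ/p` (`eu = p − 1`) and ONE value. The character is NOT data: on the (G)-cell `e ∣ p − 1`
(`typeG_iff_not_subM_and_semistabilityIndex_dvd`, gen 2), the Teichmüller power `ω^{(p−1)/e}` EXISTS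
in the tree (cc-typer-1's `CensusX43.exists_isTeichmullerPow`) and has order `e`
(cc-typer-2's `orderOf_eq_of_isTeichmullerPow`). Eliminating it:

* **`charLamLeAt_of_thm1_of_thmC_of_norm_ratTwistedSymbolSum'`** — `p ≥ 5`, ADDITIVE, (G)-ordinary,
  non-CM, `e = semistabilityIndex W p ∈ {3,4,6}`, newform `f`, plus-symbol tower bound `p^c`, and ONE
  even primitive `p`-power-order `κ` of conductor `p^{n+1+e₀}` with
  `‖Σ_b κ(b)[b/p^{n+1+e₀}]⁺_f‖^{e·φ} = (p^c)^{e·φ}·p^{−(e·k + φ)}`, `e·k < (e−2)·φ(pⁿ⁺¹)` ⟹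
  `CharLamLeAt W p k`. The twisted symbol sum does not involve any character of `ℤ/p`.
* **`ClassX4Gord.exists_schneider_rankOne_of_thm1_of_norm_ratTwistedSymbolSum'`** — X4♯(G-ord),
  `e ∈ {3,4,6}`, `ord_{s=1}L(E,s) = 1`, `p ≥ 5`, non-CM: PRINTED FACTS (Delbourgo 1998 Thm 1; 2002
  (A)(B)(C); GZK; Drinfeld–Manin) + **ONE NUMBER** `‖S(κ)‖_p^{e·φ(pⁿ⁺¹)} = p^{−(e + φ(pⁿ⁺¹))}` ⟹
  Schneider's conjecture for every (B)-datum. Compare the evolution of this sub-cell's rank-one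
  residue on defect 3/4/6: gen 20 (typed partner + `∀`-certificate), gen 24 (tower boundedness + one
  Riemann sum), gen 25 (unit root + sign certificate + one Riemann sum), gen 27 (one number). The
  X3♯(G-ord) twin keeps the plus-symbol bound `p^c` as its only other input.
* **`ClassX4Gord.padicVal_identity_rankOne_of_thm1_of_norm_ratTwistedSymbolSum'`** — at
  `rank E(ℚ) = 1`: Schneider, `#Ш[p^∞] < ∞`, `λ(fE) = 1`,
  `ord Ш[p^∞] + ord Reg_p + ord ∏c + ord ℓ = μ(fE) + 1 + 2 ord #tors` from print + one number.

* **Rank zero — `norm_ratTwistedSymbolSum_pow_eq_or_of_thm1_of_norm_ratPlusSymbol_zero`** (+ X4 form):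
  `‖[0]⁺_f‖_p = p^c` (the bound attained at `0`) ⟹ EITHER `‖S(κ)‖^e = (p^c)^e·p⁻¹` for ALL even
  primitive wild `κ` of all conductors, OR `= (p^c)^e·p^{−(e−1)}` for all of them — one valuation
  `1/e` or `1 − 1/e`, uniformly in `κ`; which one is the census dictionary (EVIDENCE, E-GAUSSCERT-R0).

EVIDENCE (not an input): the datum `ord_p S(κ₁) = 1/(p−1) + 1/e` at conductor `p²` is MET on the four
unstarred unit rows of the Gord_e346 window (2450ba1@7 (X4), 10450be1@5, 10725l1@5, 19110db1@7 (X3);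
gen 26 E-GAUSSCERT, HOME/b2b-bsdres-additive-p2/gen26/GAUSSCERT-CHECK.md; gen 27 reading
gen27/ONE-VALUE-READING.md). On STARRED rows the hypothesis is never met (the bounded character is
`ω^{(e−1)u}`; part 4 §9 applies). Nothing booked; labels UNCHANGED.

References: Delbourgo 1998 Thm. 1 [Delbourgo1998]; Delbourgo 2002 Thm. (A)(B)(C) [Delbourgo2002];
Lang Ch. 1 §2 Thm. 2.1 [Lang1990]; Mazur–Tate–Teitelbaum 1986 §I.8, §I.13–I.14
[MazurTateTeitelbaum1986Invent]; Manin 1972 Cor. 3.6 [Manin1972]. -/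

set_option autoImplicit false

noncomputable section

open scoped Classical MatrixGroups ModularForm NumberField

open CongruenceSubgroup IsDedekindDomain WeierstrassCurve NumberField
  Literature.NumberTheory.EllipticCurves
  Literature.NumberTheory.EllipticCurves.ModularForms
  Literature.NumberTheory.EllipticCurves.Rank1Residual
  Literature.NumberTheory.EllipticCurves.Rank1Residual.Typed
  Literature.NumberTheory.EllipticCurves.Delbourgo2002
  Summit.BirchSwinnertonDyer.Rank1Residual.X1.MuLambda
  Summit.BirchSwinnertonDyer.Rank1Residual.X11a.LambdaNorm

namespace Summit.BirchSwinnertonDyer.Rank1Residual.Additive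

namespace TwistPartner

section CharacterFree

variable {W : WeierstrassCurve ℚ} [W.IsElliptic] [W.IsGloballyMinimal] {p : ℕ} [hp : Fact p.Prime]
  {N : ℕ} [NeZero N] {f : CuspForm (Gamma0 N) 2}

/-- **The small Teichmüller power of order `e` exists on the (G)-cell** (`p ≥ 5`, (G)-ordinary): there
are `u` with `e·u = p − 1` and a character `χ : (ℤ/p)^× → ℚ_p` with `‖χ(a) − a^u‖_p < 1` and
`orderOf χ = e = semistabilityIndex W p` (gen 2's `e ∣ p − 1` + cc-typer-1's Teichmüller powers +
cc-typer-2's order computation). [cite: MazurTateTeitelbaum1986Invent, §I.13]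
[cite: Delbourgo1998, §1.5 (d ∣ p − 1 under (G))] -/
theorem exists_small_teichmullerPow_of_typeGOrd (h5 : 5 ≤ p) (hGord : TypeGOrd W p) :
    ∃ (u : ℕ) (χ : MulChar (ZMod p) ℚ_[p]), semistabilityIndex W p * u = p - 1 ∧
      orderOf χ = semistabilityIndex W p ∧
      ∀ a : ZMod p, a ≠ 0 → ‖χ a - ((a.val : ℕ) : ℚ_[p]) ^ u‖ < 1 := by
  have hp2 : p ≠ 2 := by omega
  obtain ⟨u, hu⟩ : semistabilityIndex W p ∣ p - 1 :=
    ((typeG_iff_not_subM_and_semistabilityIndex_dvd W p h5).mp hGord.typeG).2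
  have hu0 : 0 < u := by
    rcases Nat.eq_zero_or_pos u with h | h
    · rw [h, mul_zero] at hu; omega
    · exact h
  obtain ⟨χ, hχ⟩ := CensusX43.exists_isTeichmullerPow (p := p) hp2 u
  refine ⟨u, χ, hu.symm, ?_, hχ⟩
  rw [orderOf_eq_of_isTeichmullerPow hχ, hu, Nat.gcd_mul_left_left, Nat.mul_div_cancel _ hu0]

/-- **`CharLamLeAt W p k` FROM PRINT AND ONE VALUE — CHARACTER-FREE.** `p ≥ 5`, `E = W` non-CM,
ADDITIVE, (G)-ordinary, `e = semistabilityIndex W p ∈ {3,4,6}`, newform `f`, tower bound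
`‖[a/p^m]⁺_f‖_p ≤ p^c`, and ONE even primitive `p`-power-order `κ` of conductor `p^{n+1+e₀}` with
**`‖Σ_b κ(b)[b/p^{n+1+e₀}]⁺_f‖_p^{e·φ(pⁿ⁺¹)} = (p^c)^{e·φ}·p^{−(e·k + φ)}`**, **`e·k < (e−2)·φ(pⁿ⁺¹)`**
⟹ `CharLamLeAt W p k` (Delbourgo 1998 Thm 1 + 2002 (A)(C) + Stickelberger + the one-value
certificate; the character `ω^{(p−1)/e}` of part 4 is supplied by the tree). Nothing booked.
[cite: Delbourgo1998, Theorem 1 (p. 131)] [cite: Delbourgo2002, Theorem (A), (C) (p. 40)]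
[cite: Lang1990, Ch. 1 §2 Thm. 2.1] [cite: MazurTateTeitelbaum1986Invent, §I.8, §I.13–I.14] -/
theorem charLamLeAt_of_thm1_of_thmC_of_norm_ratTwistedSymbolSum'
    (hD : Delbourgo1998.thm1_exists_bounded_evenMeasure)
    (hC : Delbourgo2002.thmC_charIdeal_dvd_tameBranch) (hDel : Delbourgo2002.mainTheorem)
    (hDelM : Delbourgo2002.mainTheorem_potMult) (h5 : 5 ≤ p) (hcm : ¬ W.HasCM) (hadd : Addv W p)
    (hGord : TypeGOrd W p) (he : semistabilityIndex W p ∈ ({3, 4, 6} : Finset ℕ))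
    (hf : IsNewformOf W f) {c : ℕ}
    (hc : ∀ (m : ℕ) (a : ℤ), ‖((ratPlusSymbol f ((a : ℚ) / (p : ℚ) ^ m) : ℚ) : ℚ_[p])‖ ≤ (p : ℝ) ^ c)
    {n : ℕ} {κ : DirichletCharacter ℂ_[p] (p ^ (n + 1 + cyclotomicExponent p))} (hκ : κ.IsPrimitive)
    (heven : κ.Even) (hord : ∃ j : ℕ, orderOf κ = p ^ j) {k : ℕ}
    (hke : semistabilityIndex W p * k < (semistabilityIndex W p - 2) * Nat.totient (p ^ (n + 1)))
    (hval : ‖ratTwistedSymbolSum f κ‖ ^ (semistabilityIndex W p * Nat.totient (p ^ (n + 1))) =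
      ((p : ℝ) ^ c) ^ (semistabilityIndex W p * Nat.totient (p ^ (n + 1))) *
        ((p : ℝ)⁻¹) ^ (semistabilityIndex W p * k + Nat.totient (p ^ (n + 1)))) :
    CharLamLeAt W p k := by
  obtain ⟨u, χ, hu, hχe, hteich⟩ := exists_small_teichmullerPow_of_typeGOrd (W := W) h5 hGord
  exact charLamLeAt_of_thm1_of_thmC_of_norm_ratTwistedSymbolSum hD hC hDel hDelM h5 hcm hadd hGord he
    hf hχe hu hteich hc hκ heven hord hke hval

/-- **Schneider at `ord_{s=1}L(E,s) = 1` FROM PRINT AND ONE NUMBER — CHARACTER-FREE** (general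
locus: `p ≥ 5`, ADDITIVE, (G)-ordinary, non-CM, `e ∈ {3,4,6}`, plus-symbol bound `p^c`): ONE `κ` of
conductor `p^{n+1+e₀}` with `‖S(κ)‖^{e·φ} = (p^c)^{e·φ}·p^{−(e + φ)}` ⟹ Schneider's conjecture for every
(B)-datum of Delbourgo 2002, and one exists. [cite: Delbourgo1998, Theorem 1 (p. 131)]
[cite: Delbourgo2002, Theorem (A), (B), (C) (p. 40)] [cite: Lang1990, Ch. 1 §2 Thm. 2.1] -/
theorem exists_schneider_rankOne_of_thm1_of_norm_ratTwistedSymbolSum'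
    (hD : Delbourgo1998.thm1_exists_bounded_evenMeasure)
    (hC : Delbourgo2002.thmC_charIdeal_dvd_tameBranch) (hDel : Delbourgo2002.mainTheorem)
    (hDelM : Delbourgo2002.mainTheorem_potMult) (hGZK : rank_eq_analyticRank_of_analyticRank_le_one)
    (h5 : 5 ≤ p) (hcm : ¬ W.HasCM) (hadd : Addv W p) (hGord : TypeGOrd W p)
    (he : semistabilityIndex W p ∈ ({3, 4, 6} : Finset ℕ)) (hr : W.analyticRank = 1)
    (hf : IsNewformOf W f) {c : ℕ}
    (hc : ∀ (m : ℕ) (a : ℤ), ‖((ratPlusSymbol f ((a : ℚ) / (p : ℚ) ^ m) : ℚ) : ℚ_[p])‖ ≤ (p : ℝ) ^ c)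
    {n : ℕ} {κ : DirichletCharacter ℂ_[p] (p ^ (n + 1 + cyclotomicExponent p))} (hκ : κ.IsPrimitive)
    (heven : κ.Even) (hord : ∃ j : ℕ, orderOf κ = p ^ j)
    (hval : ‖ratTwistedSymbolSum f κ‖ ^ (semistabilityIndex W p * Nat.totient (p ^ (n + 1))) =
      ((p : ℝ) ^ c) ^ (semistabilityIndex W p * Nat.totient (p ^ (n + 1))) *
        ((p : ℝ)⁻¹) ^ (semistabilityIndex W p + Nat.totient (p ^ (n + 1)))) :
    (∀ Dh : PAdicHeightData W p, LeadingTermClauses W p Dh → SchneiderConjecture Dh) ∧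
      ∃ Dh : PAdicHeightData W p, LeadingTermClauses W p Dh ∧ SchneiderConjecture Dh := by
  obtain ⟨u, χ, hu, hχe, hteich⟩ := exists_small_teichmullerPow_of_typeGOrd (W := W) h5 hGord
  exact exists_schneider_rankOne_of_thm1_of_norm_ratTwistedSymbolSum hD hC hDel hDelM hGZK h5 hcm hadd
    hGord he hr hf hχe hu hteich hc hκ heven hord hval

/-- **X4♯(G-ord), defect 3, 4, 6, `ord_{s=1}L(E,s) = 1`, `p ≥ 5`, non-CM — SCHNEIDER FROM PRINTED
FACTS AND ONE NUMBER, character-free.** Printed: Delbourgo 1998 Thm. 1; Delbourgo 2002 (A), (B), (C);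
GZK; Drinfeld–Manin integrality on X4. Per pair: ONE even primitive `p`-power-order `κ` of conductor
`p^{n+1+e₀}` with **`‖Σ_b κ(b)[b/p^{n+1+e₀}]⁺_f‖_p^{e·φ(pⁿ⁺¹)} = p^{−(e + φ(pⁿ⁺¹))}`**, `e =
semistabilityIndex W p` (i.e. `ord_p S(κ) = 1/φ(pⁿ⁺¹) + 1/e`). Then Schneider's conjecture holds for
every (B)-datum. NO (G)-field, NO unit root, NO character, NO forced partner, NO sign certificate, NO
Riemann sum. EVIDENCE (not an input): met at conductor `7²` on 2450ba1@7 (`ord_7 S(κ₁) = 1/2`, gen 26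
E-GAUSSCERT). Nothing booked; X4♯(G-ord) stays CONSTRUCTION-SHAPED. [cite: Delbourgo1998, Theorem 1 (p. 131)]
[cite: Delbourgo2002, Theorem (A), (B), (C) (p. 40)] [cite: Manin1972, Cor. 3.6]
[cite: Lang1990, Ch. 1 §2 Thm. 2.1] -/
theorem ClassX4Gord.exists_schneider_rankOne_of_thm1_of_norm_ratTwistedSymbolSum'
    (hD : Delbourgo1998.thm1_exists_bounded_evenMeasure)
    (hC : Delbourgo2002.thmC_charIdeal_dvd_tameBranch) (hDel : Delbourgo2002.mainTheorem)
    (hDelM : Delbourgo2002.mainTheorem_potMult) (hGZK : rank_eq_analyticRank_of_analyticRank_le_one)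
    (hX : ClassX4Gord W p) (h5 : 5 ≤ p) (hcm : ¬ W.HasCM)
    (he : semistabilityIndex W p ∈ ({3, 4, 6} : Finset ℕ)) (hr : W.analyticRank = 1)
    (hf : IsNewformOf W f)
    {n : ℕ} {κ : DirichletCharacter ℂ_[p] (p ^ (n + 1 + cyclotomicExponent p))} (hκ : κ.IsPrimitive)
    (heven : κ.Even) (hord : ∃ j : ℕ, orderOf κ = p ^ j)
    (hval : ‖ratTwistedSymbolSum f κ‖ ^ (semistabilityIndex W p * Nat.totient (p ^ (n + 1))) =
      ((p : ℝ)⁻¹) ^ (semistabilityIndex W p + Nat.totient (p ^ (n + 1)))) :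
    (∀ Dh : PAdicHeightData W p, LeadingTermClauses W p Dh → SchneiderConjecture Dh) ∧
      ∃ Dh : PAdicHeightData W p, LeadingTermClauses W p Dh ∧ SchneiderConjecture Dh := by
  obtain ⟨u, χ, hu, hχe, hteich⟩ := exists_small_teichmullerPow_of_typeGOrd (W := W) h5 hX.typeGOrd
  exact ClassX4Gord.exists_schneider_rankOne_of_thm1_of_norm_ratTwistedSymbolSum hD hC hDel hDelM hGZK
    hX h5 hcm he hr hf hχe hu hteich hκ heven hord hval

/-- **X3♯(G-ord), defect 3, 4, 6, `ord_{s=1}L(E,s) = 1`, `p ≥ 5`, non-CM — character-free twin with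
the tower bound `p^c` of the plus symbols**: printed facts + `hc` + ONE `κ` with
`‖S(κ)‖^{e·φ} = (p^c)^{e·φ}·p^{−(e + φ)}` ⟹ Schneider for Delbourgo's datum. Nothing booked;
X3♯(G-ord) CONSTRUCTION-SHAPED. [cite: Delbourgo1998, Theorem 1 (p. 131)]
[cite: Delbourgo2002, Theorem (A), (B), (C) (p. 40)] [cite: Lang1990, Ch. 1 §2 Thm. 2.1] -/
theorem ClassX3Gord.exists_schneider_rankOne_of_thm1_of_norm_ratTwistedSymbolSum'
    (hD : Delbourgo1998.thm1_exists_bounded_evenMeasure)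
    (hC : Delbourgo2002.thmC_charIdeal_dvd_tameBranch) (hDel : Delbourgo2002.mainTheorem)
    (hDelM : Delbourgo2002.mainTheorem_potMult) (hGZK : rank_eq_analyticRank_of_analyticRank_le_one)
    (hX : ClassX3Gord W p) (h5 : 5 ≤ p) (hcm : ¬ W.HasCM)
    (he : semistabilityIndex W p ∈ ({3, 4, 6} : Finset ℕ)) (hr : W.analyticRank = 1)
    (hf : IsNewformOf W f) {c : ℕ}
    (hc : ∀ (m : ℕ) (a : ℤ), ‖((ratPlusSymbol f ((a : ℚ) / (p : ℚ) ^ m) : ℚ) : ℚ_[p])‖ ≤ (p : ℝ) ^ c)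
    {n : ℕ} {κ : DirichletCharacter ℂ_[p] (p ^ (n + 1 + cyclotomicExponent p))} (hκ : κ.IsPrimitive)
    (heven : κ.Even) (hord : ∃ j : ℕ, orderOf κ = p ^ j)
    (hval : ‖ratTwistedSymbolSum f κ‖ ^ (semistabilityIndex W p * Nat.totient (p ^ (n + 1))) =
      ((p : ℝ) ^ c) ^ (semistabilityIndex W p * Nat.totient (p ^ (n + 1))) *
        ((p : ℝ)⁻¹) ^ (semistabilityIndex W p + Nat.totient (p ^ (n + 1)))) :
    (∀ Dh : PAdicHeightData W p, LeadingTermClauses W p Dh → SchneiderConjecture Dh) ∧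
      ∃ Dh : PAdicHeightData W p, LeadingTermClauses W p Dh ∧ SchneiderConjecture Dh := by
  obtain ⟨u, χ, hu, hχe, hteich⟩ := exists_small_teichmullerPow_of_typeGOrd (W := W) h5 hX.typeGOrd
  exact ClassX3Gord.exists_schneider_rankOne_of_thm1_of_norm_ratTwistedSymbolSum hD hC hDel hDelM hGZK
    hX h5 hcm he hr hf hχe hu hteich hc hκ heven hord hval

/-- **X4♯(G-ord), defect 3, 4, 6, `rank E(ℚ) = 1`, `p ≥ 5`, non-CM — THE VALUATION IDENTITY FROM
PRINTED FACTS AND ONE NUMBER, character-free**: for every (B)-datum `Dh` and every Pontryagin-dual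
datum with `char = (fE)`: Schneider, `#Ш[p^∞] < ∞`, `λ(fE) = 1`, and
`ord Ш[p^∞] + ord Reg_p(Dh) + ord ∏c + ord ℓ = μ(fE) + 1 + 2 ord #E(ℚ)_tors`, `ℓ ∣ p²`, `ℓ = 1` off the
anomalous rows. Nothing booked. [cite: Delbourgo1998, Theorem 1 (p. 131)]
[cite: Delbourgo2002, Theorem (A), (B), (C) (p. 40)] [cite: Manin1972, Cor. 3.6] [cite: Lang1990, Ch. 1 §2 Thm. 2.1] -/
theorem ClassX4Gord.padicVal_identity_rankOne_of_thm1_of_norm_ratTwistedSymbolSum'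
    (hD : Delbourgo1998.thm1_exists_bounded_evenMeasure)
    (hC : Delbourgo2002.thmC_charIdeal_dvd_tameBranch) (hDel : Delbourgo2002.mainTheorem)
    (hDelM : Delbourgo2002.mainTheorem_potMult) (hX : ClassX4Gord W p) (h5 : 5 ≤ p) (hcm : ¬ W.HasCM)
    (he : semistabilityIndex W p ∈ ({3, 4, 6} : Finset ℕ)) (hrk : W.mordellWeilRank = 1)
    (hf : IsNewformOf W f)
    {n : ℕ} {κ : DirichletCharacter ℂ_[p] (p ^ (n + 1 + cyclotomicExponent p))} (hκ : κ.IsPrimitive)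
    (heven : κ.Even) (hord : ∃ j : ℕ, orderOf κ = p ^ j)
    (hval : ‖ratTwistedSymbolSum f κ‖ ^ (semistabilityIndex W p * Nat.totient (p ^ (n + 1))) =
      ((p : ℝ)⁻¹) ^ (semistabilityIndex W p + Nat.totient (p ^ (n + 1))))
    {Dh : PAdicHeightData W p} (hBcl : LeadingTermClauses W p Dh)
    {K : ZpExtension ℚ p} {γ : Field.absoluteGaloisGroup ℚ}
    (hK : K.IsCyclotomic) (hγ : K.IsTopGenerator γ) (hcv : IsCyclotomicVariable p γ)
    (D : W.SelmerDualData K γ) [Module.Finite (IwasawaAlgebra p) D.X]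
    {fE : IwasawaAlgebra p} (hchar : D.charIdeal = Ideal.span {fE}) :
    SchneiderConjecture Dh ∧ Finite (AddCommGroup.primaryComponent W.sha p) ∧
      X1.MuLambda.lam fE = 1 ∧
      ∃ ℓ : ℕ, ℓ ∣ p ^ 2 ∧ (ReductionNonAnomalous W p → ℓ = 1) ∧
        (padicValNat p (Nat.card (AddCommGroup.primaryComponent W.sha p)) : ℤ) +
            (padicRegulator Dh).valuation + padicValNat p W.tamagawaProduct + padicValNat p ℓ =
          X1.MuLambda.mu fE + 1 + 2 * padicValNat p W.torsionOrder := by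
  obtain ⟨u, χ, hu, hχe, hteich⟩ := exists_small_teichmullerPow_of_typeGOrd (W := W) h5 hX.typeGOrd
  exact ClassX4Gord.padicVal_identity_rankOne_of_thm1_of_norm_ratTwistedSymbolSum hD hC hDel hDelM hX
    h5 hcm he hrk hf hχe hu hteich hκ heven hord hval hBcl hK hγ hcv D hchar

/-! ### Rank zero: ONE valuation for ALL wild twisted symbol sums -/

/-- **RANK ZERO — the wild twisted symbol sums have ONE `p`-adic absolute value, uniformly in the
character: `‖S(κ)‖^e = (p^c)^e·p⁻¹` for ALL even primitive wild `κ`, or `= (p^c)^e·p^{−(e−1)}` for ALL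
of them.** `p ≥ 5`, ADDITIVE, (G)-ordinary, `e = semistabilityIndex W p ∈ {3,4,6}`, newform `f`,
plus-symbol tower bound `p^c` ATTAINED AT `0` (`‖[0]⁺_f‖_p = p^c`; on X4: `ord_p[0]⁺_f = 0`, which forces
`L(E,1) ≠ 0`). Mechanism: Delbourgo 1998 Thm 1 gives a bounded branch `B` for `(χ₀, ã₀)`; its constant
term `ã₀⁻¹[0]⁺_f` is the FIRST top coefficient (`k = 0`), so the one-value law gives
`p‖τ(ι∘χ₀,ψ_κ)‖‖S(κ)‖ = p^c` for EVERY wild `κ`; `χ₀ ∈ {ω^u, ω^{−u}}` and Stickelberger evaluates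
`‖τ‖^e ∈ {p^{−(e−1)}, p⁻¹}`. Which alternative holds (the census dictionary: `1/e` on II/III/IV, `1 − 1/e`
on IV*/III*/II*) is NOT asserted. Tested as EVIDENCE by E-GAUSSCERT-R0 (gen 27, 177 rank-0 rows).
[cite: Delbourgo1998, Theorem 1 (p. 131)] [cite: Lang1990, Ch. 1 §2 Thm. 2.1]
[cite: MazurTateTeitelbaum1986Invent, §I.8, §I.14 (14.3)] -/
theorem norm_ratTwistedSymbolSum_pow_eq_or_of_thm1_of_norm_ratPlusSymbol_zero
    (hD : Delbourgo1998.thm1_exists_bounded_evenMeasure) (h5 : 5 ≤ p) (hadd : Addv W p)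
    (hGord : TypeGOrd W p) (he : semistabilityIndex W p ∈ ({3, 4, 6} : Finset ℕ))
    (hf : IsNewformOf W f) {c : ℕ}
    (hc : ∀ (m : ℕ) (a : ℤ), ‖((ratPlusSymbol f ((a : ℚ) / (p : ℚ) ^ m) : ℚ) : ℚ_[p])‖ ≤ (p : ℝ) ^ c)
    (h0 : ‖((ratPlusSymbol f 0 : ℚ) : ℚ_[p])‖ = (p : ℝ) ^ c) :
    (∀ (m : ℕ) (_ : 2 ≤ m) (κ : DirichletCharacter ℂ_[p] (p ^ m)), κ.IsPrimitive → κ.Even →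
        (∃ j : ℕ, orderOf κ = p ^ j) →
        ‖ratTwistedSymbolSum f κ‖ ^ semistabilityIndex W p =
          ((p : ℝ) ^ c) ^ semistabilityIndex W p * (p : ℝ)⁻¹) ∨
    (∀ (m : ℕ) (_ : 2 ≤ m) (κ : DirichletCharacter ℂ_[p] (p ^ m)), κ.IsPrimitive → κ.Even →
        (∃ j : ℕ, orderOf κ = p ^ j) →
        ‖ratTwistedSymbolSum f κ‖ ^ semistabilityIndex W p =
          ((p : ℝ) ^ c) ^ semistabilityIndex W p * ((p : ℝ)⁻¹) ^ (semistabilityIndex W p - 1)) := by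
  have hp2 : p ≠ 2 := by omega
  have hp0 : (p : ℝ) ≠ 0 := Nat.cast_ne_zero.mpr hp.out.ne_zero
  have hp1 : (1 : ℝ) < p := by exact_mod_cast hp.out.one_lt
  have h2 : 2 ≤ semistabilityIndex W p := by
    simp only [Finset.mem_insert, Finset.mem_singleton] at he; omega
  have hG : SubGord W p := (subGord_iff_typeG_of_addv W p hp2 hadd).mpr hGord.typeG
  obtain ⟨χ₀, ã₀, B, hord0, hã₀, hB, hint⟩ := exists_isTameBranchOf_of_thm1 hD h5 hadd hGord he hf
  have hbd : ∀ j : ℕ, ‖PowerSeries.coeff j B‖ ≤ (p : ℝ) ^ c := hint _ hc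
  -- the constant term is the first top coefficient
  have hk : ‖PowerSeries.coeff 0 B‖ = (p : ℝ) ^ c := by
    rw [PowerSeries.coeff_zero_eq_constantCoeff, hB.constantCoeff, norm_mul, norm_inv, hã₀, inv_one,
      one_mul, h0]
  have hrow : ∀ (m : ℕ) (_ : 2 ≤ m) (κ : DirichletCharacter ℂ_[p] (p ^ m)), κ.IsPrimitive → κ.Even →
      (∃ j : ℕ, orderOf κ = p ^ j) →
      (p : ℝ) * ‖tameGaussSum p (χ₀.ringHomComp (algebraMap ℚ_[p] ℂ_[p])) κ‖ *
        ‖ratTwistedSymbolSum f κ‖ = (p : ℝ) ^ c := by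
    intro m hm κ hκ heven hord
    have h := hB.mul_norm_tameGaussSum_mul_norm_eq_of_firstTop hã₀ hbd hk
      (fun i hi ↦ absurd hi (Nat.not_lt_zero i)) hm hκ heven hord
      (by rw [pow_zero]; exact inv_lt_one_of_one_lt₀ hp1)
    rwa [pow_zero, mul_one] at h
  have hord0' : orderOf χ₀ = semistabilityIndex W p := by
    have h := hord0
    rwa [orderOf_ringHomComp_padicComplex, tameDefect_of_not_potMult W p hG.1] at h
  obtain ⟨u, χ, hu, hχe, hteich⟩ := exists_small_teichmullerPow_of_typeGOrd (W := W) h5 hGord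
  rcases eq_or_eq_inv_of_orderOf_eq he hχe hord0' with hc0 | hc0
  · -- `χ₀ = ω^u`: `‖τ‖^e = p^{−(e−1)}`, so `‖S‖^e = (p^c)^e·p⁻¹`
    left
    intro m hm κ hκ heven hord
    have hX := hrow m hm κ hκ heven hord
    rw [hc0] at hX
    have hτ := norm_tameGaussSum_pow_eq_of_teichmullerPow hteich hχe h2 hu hm hκ
    have h1 := congrArg (· ^ semistabilityIndex W p) hX
    simp only [mul_pow] at h1
    rw [hτ, pow_mul_inv_pow_sub_one (by omega)] at h1
    -- `p * S^e = (p^c)^e`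
    calc ‖ratTwistedSymbolSum f κ‖ ^ semistabilityIndex W p
        = (p : ℝ)⁻¹ * ((p : ℝ) * ‖ratTwistedSymbolSum f κ‖ ^ semistabilityIndex W p) := by
          rw [inv_mul_cancel_left₀ hp0]
      _ = ((p : ℝ) ^ c) ^ semistabilityIndex W p * (p : ℝ)⁻¹ := by rw [h1, mul_comm]
  · -- `χ₀ = ω^{−u}`: `‖τ‖^e = p⁻¹`, so `‖S‖^e = (p^c)^e·p^{−(e−1)}`
    right
    intro m hm κ hκ heven hord
    have hX := hrow m hm κ hκ heven hord
    rw [hc0] at hX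
    have hτ := norm_tameGaussSum_inv_pow_eq_of_teichmullerPow hteich hχe h2 hu hm hκ
    have h1 := congrArg (· ^ semistabilityIndex W p) hX
    simp only [mul_pow] at h1
    rw [hτ, pow_mul_inv_eq_pow_sub_one (by omega)] at h1
    -- `p^{e−1} * S^e = (p^c)^e`
    have hpe : (p : ℝ) ^ (semistabilityIndex W p - 1) ≠ 0 := pow_ne_zero _ hp0
    calc ‖ratTwistedSymbolSum f κ‖ ^ semistabilityIndex W p
        = ((p : ℝ) ^ (semistabilityIndex W p - 1))⁻¹ *
            ((p : ℝ) ^ (semistabilityIndex W p - 1) *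
              ‖ratTwistedSymbolSum f κ‖ ^ semistabilityIndex W p) := by
          rw [inv_mul_cancel_left₀ hpe]
      _ = ((p : ℝ) ^ c) ^ semistabilityIndex W p * ((p : ℝ)⁻¹) ^ (semistabilityIndex W p - 1) := by
          rw [h1, inv_pow, mul_comm]

/-- **X4♯(G-ord), defect 3, 4, 6, `p ≥ 5`, `ord_p[0]⁺_f = 0` — ALL wild twisted symbol sums have the
SAME valuation, `1/e` or `1 − 1/e`**: from Delbourgo 1998 Thm 1 + Drinfeld–Manin + the one-value law at
`k = 0` + Stickelberger: either `‖Σ_b κ(b)[b/p^m]⁺_f‖_p^e = p⁻¹` for EVERY even primitive `p`-power-order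
`κ` of EVERY conductor `p^m ≥ p²`, or `= p^{−(e−1)}` for every such `κ`. No rank hypothesis beyond
`[0]⁺_f` a `p`-unit; nothing about WHICH alternative (census dictionary) is asserted. Nothing booked.
[cite: Delbourgo1998, Theorem 1 (p. 131)] [cite: Manin1972, Cor. 3.6] [cite: Lang1990, Ch. 1 §2 Thm. 2.1] -/
theorem ClassX4Gord.norm_ratTwistedSymbolSum_pow_eq_or_of_thm1_of_norm_ratPlusSymbol_zero
    (hD : Delbourgo1998.thm1_exists_bounded_evenMeasure) (hX : ClassX4Gord W p) (h5 : 5 ≤ p)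
    (he : semistabilityIndex W p ∈ ({3, 4, 6} : Finset ℕ)) (hf : IsNewformOf W f)
    (h0 : ‖((ratPlusSymbol f 0 : ℚ) : ℚ_[p])‖ = 1) :
    (∀ (m : ℕ) (_ : 2 ≤ m) (κ : DirichletCharacter ℂ_[p] (p ^ m)), κ.IsPrimitive → κ.Even →
        (∃ j : ℕ, orderOf κ = p ^ j) →
        ‖ratTwistedSymbolSum f κ‖ ^ semistabilityIndex W p = (p : ℝ)⁻¹) ∨
    (∀ (m : ℕ) (_ : 2 ≤ m) (κ : DirichletCharacter ℂ_[p] (p ^ m)), κ.IsPrimitive → κ.Even →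
        (∃ j : ℕ, orderOf κ = p ^ j) →
        ‖ratTwistedSymbolSum f κ‖ ^ semistabilityIndex W p =
          ((p : ℝ)⁻¹) ^ (semistabilityIndex W p - 1)) := by
  have hc : ∀ (m : ℕ) (a : ℤ),
      ‖((ratPlusSymbol f ((a : ℚ) / (p : ℚ) ^ m) : ℚ) : ℚ_[p])‖ ≤ (p : ℝ) ^ (0 : ℕ) := fun m a ↦ by
    rw [pow_zero]
    exact plusSymbolsPIntegralAt_of_classX4 W p hX.1 f hf _
  have h0' : ‖((ratPlusSymbol f 0 : ℚ) : ℚ_[p])‖ = (p : ℝ) ^ (0 : ℕ) := by rw [pow_zero]; exact h0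
  rcases TwistPartner.norm_ratTwistedSymbolSum_pow_eq_or_of_thm1_of_norm_ratPlusSymbol_zero hD h5
    hX.addv.2 hX.typeGOrd he hf hc h0' with h | h
  · left
    intro m hm κ hκ heven hord
    have := h m hm κ hκ heven hord
    rwa [pow_zero, one_pow, one_mul] at this
  · right
    intro m hm κ hκ heven hord
    have := h m hm κ hκ heven hord
    rwa [pow_zero, one_pow, one_mul] at this

end CharacterFree

end TwistPartner

end Summit.BirchSwinnertonDyer.Rank1Residual.Additive

end
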